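import Mathlib.Analysis.InnerProductSpace.Laplacian
import Mathlib.Analysis.Calculus.Deriv.Basic
import Mathlib.Analysis.Calculus.ContDiff.Basic
import Literature.Analysis.FluidPDE.VectorCalculus
import Literature.Analysis.FunctionSpaces.TorusFluidGlue
import HarnessLib

-- provenance: harness21/H21/H21/Prelude/FluidKinetic/ClassicalSolution.lean @ 60bf3b1 (interim HEAD d8f2665); M5 mechanical rewrite
/-!
# Classical (smooth) solutions of the incompressible Navier–Stokes / Euler equations

Trunk: FluidKinetic (outline `H21/Outlines/FluidKinetic.md`, item F2 `ClassicalSolution`; notions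
`ns_classical_solution`, `clay_data_force_classes`).

Let `E` be a finite-dimensional real inner product space (physical space; the Clay statements
take `E = ℝ³`). A *classical solution* of the forced incompressible Navier–Stokes system with
viscosity `ν` on a time set `S ⊆ ℝ` is a pair `(u, p)`, `u : ℝ → E → E`, `p : ℝ → E → ℝ`
(time first), jointly `C^∞` on `S × E`, with
`∂ₜu + (u·∇)u = νΔu − ∇p + f`, `div u = 0` pointwise on `S × E`
(Fefferman, eqs. (1)–(3), (6); Beale–Kato–Majda 1984, §1). Euler is `ν = 0`.

## Main definitions

* `Literature.Fluid.IsSmoothSpaceTimeOn S w`: `uncurry w` is `C^∞` on `S ×ˢ univ`; for `S = Ici 0` this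
  is *verbatim* the accepted `Literature.NS.IsSmoothOnHalfSpace w` (Statements/NS/Wave0, not imported
  here so that the prelude stays independent of statement files).
* `Literature.Fluid.timeDerivWithin S u t x = derivWithin (u · x) S t`: the **one-sided** time
  derivative within `S`, the convention of `Literature.Analysis.FluidPDE.IsNavierStokesSolution`
  (`derivWithin _ (Ici 0) t`) and of the torus twin `Literature.Analysis.FunctionSpaces.Torus.timeDerivWithin`.
* `Literature.Fluid.IsClassicalNSSolutionOn S ν f u p`: the structure with **exactly** the four fields
  of the accepted torus twin `Literature.Analysis.FunctionSpaces.Torus.IsClassicalNSSolutionOn` (`smooth_velocity`,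
  `smooth_pressure`, `momentum`, `divFree`); `Literature.Fluid.IsClassicalEulerSolutionOn := … 0 …`.
* continuation vocabulary (Beale–Kato–Majda 1984, §1): `Literature.Analysis.FluidPDE.HasSmoothExtensionPast`,
  `Literature.Analysis.FluidPDE.IsMaximalSmoothSolution`.
* `Literature.Fluid.HasUniformRapidDecayOn S w`: Schwartz-type bounds on all space–time derivatives,
  uniformly in `t ∈ S` (Fefferman's (5) without the time weight; the hypothesis under which the
  energy identity `IsClassicalNSSolutionOn.hasDerivWithinAt_kineticEnergy` is stated).

## Bridges (recorded, proved elsewhere)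

* NS/Wave0 (to be proved in `Statements/NS/LerayHopf`, by `Iff.rfl` componentwise):
  `NS.IsNavierStokesSolution ν f u₀ u p ∧ NS.IsSmoothOnHalfSpace u ∧ NS.IsSmoothOnHalfSpace p ↔
   Fluid.IsClassicalNSSolutionOn (Ici 0) ν f u p ∧ u 0 = u₀`
  (`NS`'s momentum field is `derivWithin (fun s ↦ u s x) (Ici 0) t + fderiv ℝ (u t) x (u t x) =
  ν • Δ (u t) x - gradient (p t) x + f t x`, definitionally our `momentum` at `S = Ici 0`).
* torus (this file): `IsClassicalNSSolutionOn.of_torus`, `isSmoothSpaceTimeOn_iff_torus`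
  (the latter is `Iff.rfl`: `uncurry (fun t ↦ Torus.lift (u t)) = Torus.stLift u`); the named facts
  `of_torus`, `to_torus`, `isClassicalNSSolutionOn_lift_iff` are proved in `ClassicalSolutionTorusProofs`.

## The Clay data/force classes (`clay_data_force_classes`)

This notion is fully realised by the accepted `Statements/NS/Wave0` and nothing is added here:
Fefferman (4) = `NS.HasRapidSpatialDecay u₀`, (5) = `NS.HasRapidSpaceTimeDecay f`,
(7) = `NS.HasBoundedEnergy u`, (8)/(10) = `NS.IsLatticePeriodic`, (9) = `NS.HasRapidTimeDecay f`,
(6)/(11) = `NS.IsSmoothOnHalfSpace` (= `IsSmoothSpaceTimeOn (Ici 0)`).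

## Mathlib search

Mathlib (this pin) has no Navier–Stokes/Euler notions (searched `NavierStokes`, `Euler` in
`Analysis/`, `incompressible`: none). Everything below is a thin layer over Mathlib's
`ContDiffOn`, `derivWithin`, `fderiv`, `gradient`, `InnerProductSpace.laplacian` (`Δ`),
`iteratedFDerivWithin`, `HasDerivWithinAt`, `UniqueDiffOn`, and the accepted `Literature.Fluid.*`
operators of `VectorCalculus`.

## Design notes

* Only the `ContDiff` and `Laplacian` scopes are opened (`∞` would be ambiguous with `ENNReal`).
* Initial data are **not** part of `IsClassicalNSSolutionOn`; statements add `u 0 = u₀`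
  (as for the torus twin).
* `IsClassicalNSSolutionOn.mono` is stated for `S' ⊆ S` with `UniqueDiffOn ℝ S'` (covers open
  sets and all non-degenerate intervals): `derivWithin` depends on the time set, and on a set of
  unique differentiability the restricted one-sided derivative agrees with the original one.

## References

* C. L. Fefferman, *Existence and smoothness of the Navier–Stokes equation*, Clay Millennium
  problem description (2000/2006), eqs. (1)–(11), statements (A)–(D).
* J. T. Beale, T. Kato, A. Majda, *Remarks on the breakdown of smooth solutions for the 3-D
  Euler equations*, Comm. Math. Phys. 94 (1984), §1.
* A. J. Majda, A. L. Bertozzi, *Vorticity and Incompressible Flow* (CUP 2002), §1.2,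
  Prop. 1.13 (energy identity), §3.1.
* P. G. Lemarié-Rieusset, *The Navier–Stokes Problem in the 21st Century* (CRC Press, 2016), §1.3,
  eqs. (1.10)–(1.13), problems (B), (D) (the periodic problem = the problem on `ℝ³/ℤ³`).
-/

noncomputable section

open MeasureTheory Set Function
open scoped ContDiff Laplacian InnerProductSpace RealInnerProductSpace

namespace Literature.Analysis.FluidPDE

/-! ### Space–time smoothness and the one-sided time derivative -/

section SpaceTime

variable {X : Type*} [NormedAddCommGroup X] [NormedSpace ℝ X]
variable {F : Type*} [NormedAddCommGroup F] [NormedSpace ℝ F]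

/-- Joint smoothness of a time-dependent field `w : ℝ → X → F` on the time set `S`
(e.g. `Ici 0`, `Icc 0 T`, `Ico 0 T`): the uncurried field is `C^∞` on `S ×ˢ univ`
(Fefferman, eqs. (6), (11): `p, u ∈ C^∞(ℝⁿ × [0,∞))`). For `S = Ici 0` this is **verbatim** the
accepted `Literature.NS.IsSmoothOnHalfSpace w`; the torus twin is `Literature.Analysis.FunctionSpaces.Torus.IsSmoothSpaceTimeOn`
(`isSmoothSpaceTimeOn_iff_torus`). [folklore] -/
def IsSmoothSpaceTimeOn (S : Set ℝ) (w : ℝ → X → F) : Prop :=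
  ContDiffOn ℝ ∞ (uncurry w) (S ×ˢ univ)

omit [NormedAddCommGroup X] [NormedSpace ℝ X] in
/-- The time derivative `∂ₜ u (t, x)` of `u : ℝ → X → F` *within* the time set `S`
(Mathlib `derivWithin`, hence one-sided at endpoints of `S`), the convention of the accepted
`Literature.Analysis.FluidPDE.IsNavierStokesSolution` (`derivWithin _ (Ici 0) t`; Fefferman, eq. (1)) and of
`Literature.Analysis.FunctionSpaces.Torus.timeDerivWithin`. Junk value `0` where not differentiable within `S`. [folklore] -/
def timeDerivWithin (S : Set ℝ) (u : ℝ → X → F) (t : ℝ) (x : X) : F :=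
  derivWithin (fun s => u s x) S t

omit [NormedAddCommGroup X] [NormedSpace ℝ X] in
/-- Unfolding `timeDerivWithin` (Fefferman, eq. (1)). [folklore] -/
@[simp]
theorem timeDerivWithin_apply (S : Set ℝ) (u : ℝ → X → F) (t : ℝ) (x : X) :
    timeDerivWithin S u t x = derivWithin (fun s => u s x) S t :=
  rfl

/-- `IsSmoothSpaceTimeOn` is antitone in the time set (Mathlib `ContDiffOn.mono`). [folklore] -/
theorem IsSmoothSpaceTimeOn.mono {S S' : Set ℝ} {w : ℝ → X → F} (h : IsSmoothSpaceTimeOn S w)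
    (hS' : S' ⊆ S) : IsSmoothSpaceTimeOn S' w :=
  ContDiffOn.mono h (prod_mono hS' Subset.rfl)

/-- A jointly smooth field has smooth time slices `w t`, `t ∈ S` (compose with `x ↦ (t, x)`). [folklore] -/
theorem IsSmoothSpaceTimeOn.contDiff_slice {S : Set ℝ} {w : ℝ → X → F}
    (h : IsSmoothSpaceTimeOn S w) {t : ℝ} (ht : t ∈ S) : ContDiff ℝ ∞ (w t) := by
  have hc : ContDiff ℝ ∞ (fun x : X => ((t, x) : ℝ × X)) := contDiff_const.prodMk contDiff_id
  have := h.comp_contDiff hc (fun x => mk_mem_prod ht (mem_univ x))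
  simpa [Function.comp_def] using this

/-- For a jointly smooth field, each time line `s ↦ w s x` is differentiable within `S`
(chain rule with `s ↦ (s, x)`). [folklore] -/
theorem IsSmoothSpaceTimeOn.differentiableWithinAt_time {S : Set ℝ} {w : ℝ → X → F}
    (h : IsSmoothSpaceTimeOn S w) {t : ℝ} (ht : t ∈ S) (x : X) :
    DifferentiableWithinAt ℝ (fun s => w s x) S t := by
  have h1 : DifferentiableWithinAt ℝ (uncurry w) (S ×ˢ univ) (t, x) :=
    (h (t, x) (mk_mem_prod ht (mem_univ x))).differentiableWithinAt (by simp)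
  have h2 : DifferentiableWithinAt ℝ (fun s : ℝ => ((s, x) : ℝ × X)) S t :=
    differentiableWithinAt_id.prodMk (differentiableWithinAt_const _)
  exact h1.comp t h2 (fun s hs => mk_mem_prod hs (mem_univ x))

/-- On a smaller time set of unique differentiability the one-sided time derivative of a jointly
smooth field is unchanged (Mathlib `HasDerivWithinAt.mono`, `HasDerivWithinAt.derivWithin`). [folklore] -/
theorem IsSmoothSpaceTimeOn.timeDerivWithin_eq_of_subset {S S' : Set ℝ} {w : ℝ → X → F}
    (h : IsSmoothSpaceTimeOn S w) (hS' : S' ⊆ S) (hU : UniqueDiffOn ℝ S') {t : ℝ} (ht : t ∈ S')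
    (x : X) : timeDerivWithin S' w t x = timeDerivWithin S w t x :=
  (((h.differentiableWithinAt_time (hS' ht) x).hasDerivWithinAt).mono hS').derivWithin (hU t ht)

/-- Schwartz-type decay of all space–time derivatives of `w`, **uniformly in `t ∈ S`**:
`(1 + ‖x‖)^K ‖Dⁿ(uncurry w)(t, x)‖ ≤ C_{n,K}` on `S × X` for all `n`, `K` (the shape of
Fefferman's (5), `|∂ₓ^α ∂ₜ^m f| ≤ C (1 + |x| + t)^{-K}`, without the time weight; for
`S = Ici 0` it is implied by the accepted `Literature.Analysis.FluidPDE.HasRapidSpaceTimeDecay`). This is the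
"smooth solution vanishing sufficiently rapidly at infinity" hypothesis of the energy identity
(Majda–Bertozzi, Prop. 1.13); typically used on a compact time interval after
`IsClassicalNSSolutionOn.mono`. [folklore] -/
def HasUniformRapidDecayOn (S : Set ℝ) (w : ℝ → X → F) : Prop :=
  ∀ n K : ℕ, ∃ C : ℝ, ∀ t ∈ S, ∀ x : X,
    (1 + ‖x‖) ^ K * ‖iteratedFDerivWithin ℝ n (uncurry w) (S ×ˢ univ) (t, x)‖ ≤ C

end SpaceTime

/-! ### Classical solutions on `E × S` -/

section Classical

variable {E : Type*} [NormedAddCommGroup E] [InnerProductSpace ℝ E] [FiniteDimensional ℝ E]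

/-- Classical (smooth) solutions of the forced incompressible Navier–Stokes system with viscosity
`ν` on `E × S`, `S ⊆ ℝ` a time set (typically `Ici 0`, `Icc 0 T`, `Ico 0 T`):
`∂ₜu + (u·∇)u = νΔu − ∇p + f`, `div u = 0`, with `u`, `p` jointly `C^∞` on `S × E`
(Fefferman, eqs. (1), (2), (6); Beale–Kato–Majda 1984, §1; Euler is the case `ν = 0`). The
fields are **exactly** those of the accepted torus twin `Literature.Analysis.FunctionSpaces.Torus.IsClassicalNSSolutionOn`. The
time derivative is the one-sided `timeDerivWithin S`; initial data are a separate hypothesis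
`u 0 = u₀` in statements. Bridge to NS/Wave0 (proved in `Statements/NS/LerayHopf`):
`NS.IsNavierStokesSolution ν f u₀ u p ∧ NS.IsSmoothOnHalfSpace u ∧ NS.IsSmoothOnHalfSpace p ↔
IsClassicalNSSolutionOn (Ici 0) ν f u p ∧ u 0 = u₀`. [cite: BealeKatoMajda1984, §1] -/
structure IsClassicalNSSolutionOn (S : Set ℝ) (ν : ℝ) (f u : ℝ → E → E) (p : ℝ → E → ℝ) :
    Prop where
  /-- The velocity is jointly smooth on `S × E` (Fefferman, (6)). -/
  smooth_velocity : IsSmoothSpaceTimeOn S u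
  /-- The pressure is jointly smooth on `S × E` (Fefferman, (6)). -/
  smooth_pressure : IsSmoothSpaceTimeOn S p
  /-- The momentum equation `∂ₜu + (u·∇)u = νΔu − ∇p + f` holds pointwise on `S × E`
  (Fefferman, (1)). -/
  momentum : ∀ t ∈ S, ∀ x,
    timeDerivWithin S u t x + convect (u t) (u t) x = ν • (Δ (u t)) x - gradient (p t) x + f t x
  /-- Incompressibility `div u(t) = 0` for `t ∈ S` (Fefferman, (2)). -/
  divFree : ∀ t ∈ S, VectorCalculus.IsDivFree (u t)

/-- Classical (smooth) solutions of the forced incompressible **Euler** equations on `E × S`: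
`IsClassicalNSSolutionOn` with `ν = 0` (Beale–Kato–Majda 1984, §1, eq. (1)). [cite: BealeKatoMajda1984, §1  eq. (1] -/
abbrev IsClassicalEulerSolutionOn (S : Set ℝ) (f u : ℝ → E → E) (p : ℝ → E → ℝ) : Prop :=
  IsClassicalNSSolutionOn S 0 f u p

variable {S S' : Set ℝ} {ν : ℝ} {f u : ℝ → E → E} {p : ℝ → E → ℝ}

/-- Euler solutions are Navier–Stokes solutions with `ν = 0` (definitional). [folklore] -/
theorem isClassicalEulerSolutionOn_iff :
    IsClassicalEulerSolutionOn S f u p ↔ IsClassicalNSSolutionOn S 0 f u p :=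
  Iff.rfl

/-- The time slices `u t`, `t ∈ S`, of a classical solution are smooth (Fefferman, (6)). [folklore] -/
theorem IsClassicalNSSolutionOn.contDiff_velocity (h : IsClassicalNSSolutionOn S ν f u p) {t : ℝ}
    (ht : t ∈ S) : ContDiff ℝ ∞ (u t) :=
  h.smooth_velocity.contDiff_slice ht

/-- The time slices `p t`, `t ∈ S`, of the pressure of a classical solution are smooth
(Fefferman, (6)). [folklore] -/
theorem IsClassicalNSSolutionOn.contDiff_pressure (h : IsClassicalNSSolutionOn S ν f u p) {t : ℝ}
    (ht : t ∈ S) : ContDiff ℝ ∞ (p t) :=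
  h.smooth_pressure.contDiff_slice ht

/-- Restriction of the time set: a classical solution on `S` is a classical solution on any
`S' ⊆ S` of unique differentiability (`UniqueDiffOn ℝ S'`: e.g. `S'` open, or any interval
`Icc a b`, `Ico a b`, … with `a < b`). The hypothesis is needed because the one-sided time
derivative `derivWithin _ S' t` depends on `S'`; on such `S'` it agrees with `derivWithin _ S t`
for functions differentiable within `S` (Mathlib `HasDerivWithinAt.mono`,
`HasDerivWithinAt.derivWithin`) (Fefferman, (1)–(2) restricted in time). [folklore] -/
theorem IsClassicalNSSolutionOn.mono (h : IsClassicalNSSolutionOn S ν f u p) (hS' : S' ⊆ S)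
    (hU : UniqueDiffOn ℝ S') : IsClassicalNSSolutionOn S' ν f u p where
  smooth_velocity := h.smooth_velocity.mono hS'
  smooth_pressure := h.smooth_pressure.mono hS'
  momentum t ht x := by
    rw [h.smooth_velocity.timeDerivWithin_eq_of_subset hS' hU ht x]
    exact h.momentum t (hS' ht) x
  divFree t ht := h.divFree t (hS' ht)

/-! ### Continuation vocabulary (Beale–Kato–Majda) -/

/-- The classical solution `(u, p)` on `[0, T)` *extends smoothly past `T`*: there are `T' > T`
and a classical solution `(u', p')` of the same system (same `ν`, `f`) on `E × [0, T')` whose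
velocity agrees with `u` on `[0, T)` (Beale–Kato–Majda 1984, §1: "the solution can be continued
in the class … to a larger interval"). Only the velocity is required to agree (the pressure is
determined by `u` up to normalisation), so the predicate does not take `p` as an argument. [cite: BealeKatoMajda1984, §1: "the solution can be continued in th] -/
def HasSmoothExtensionPast (ν : ℝ) (f u : ℝ → E → E) (T : ℝ) : Prop :=
  ∃ T' > T, ∃ (u' : ℝ → E → E) (p' : ℝ → E → ℝ),
    IsClassicalNSSolutionOn (Ico 0 T') ν f u' p' ∧ ∀ t ∈ Ico 0 T, u' t = u t

/-- `(u, p)` is a *maximal smooth solution with lifespan `T`*: it is a classical solution on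
`E × [0, T)` (smoothness is part of `IsClassicalNSSolutionOn`) and admits no classical extension
to any `[0, T')`, `T' > T`, agreeing with `u` on `[0, T)` (Beale–Kato–Majda 1984, §1: `[0, T*)`
the maximal interval of smooth existence). Meaningful for `0 < T`; a global smooth solution is
never maximal in this (finite-`T`) sense. [cite: BealeKatoMajda1984, §1:   0  T] -/
def IsMaximalSmoothSolution (ν : ℝ) (f u : ℝ → E → E) (p : ℝ → E → ℝ) (T : ℝ) : Prop :=
  IsClassicalNSSolutionOn (Ico 0 T) ν f u p ∧ ¬ HasSmoothExtensionPast ν f u T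

/-- A maximal smooth solution is a classical solution on `[0, T)` (field projection). [folklore] -/
theorem IsMaximalSmoothSolution.isClassicalNSSolutionOn {T : ℝ}
    (h : IsMaximalSmoothSolution ν f u p T) : IsClassicalNSSolutionOn (Ico 0 T) ν f u p :=
  h.1

/-- A classical solution on a longer interval `[0, T')`, `T < T'`, extends (its own restriction)
past `T` (Beale–Kato–Majda 1984, §1). [cite: BealeKatoMajda1984, §1] -/
theorem IsClassicalNSSolutionOn.hasSmoothExtensionPast {T T' : ℝ} (hTT' : T < T')
    (h : IsClassicalNSSolutionOn (Ico 0 T') ν f u p) : HasSmoothExtensionPast ν f u T :=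
  ⟨T', hTT', u, p, h, fun _ _ => rfl⟩

/-- A classical solution on `[0, T')` is not maximal with any shorter lifespan `T < T'`
(Beale–Kato–Majda 1984, §1). [cite: BealeKatoMajda1984, §1] -/
theorem IsClassicalNSSolutionOn.not_isMaximalSmoothSolution {T T' : ℝ} (hTT' : T < T')
    (h : IsClassicalNSSolutionOn (Ico 0 T') ν f u p) {p' : ℝ → E → ℝ} :
    ¬ IsMaximalSmoothSolution ν f u p' T :=
  fun hmax => hmax.2 (h.hasSmoothExtensionPast hTT')

/-! ### The energy identity -/

variable [MeasurableSpace E] [BorelSpace E]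

/-- **Energy identity** for classical solutions decaying at spatial infinity: on a convex time set
`S`, `t ↦ E(u(t)) = ½ ∫ ‖u(t)‖²` has within `S` at `t` the derivative
`−ν ‖∇u(t)‖₂² + ∫ ⟪f(t), u(t)⟫`
(Majda–Bertozzi, Prop. 1.13 and eq. (1.30); Fefferman, §1, the estimate behind (7);
Doering–Foias 2002, (2.4)). Proof sketch: differentiate under the integral (dominated by the
uniform Schwartz bounds `hu`), insert the momentum equation, and use
`∫ ⟪(u·∇)u, u⟫ = 0`, `∫ ⟪Δu, u⟫ = −‖∇u‖₂²` (integration by parts, no boundary terms by decay of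
`u`) and `∫ ⟪∇p, u⟫ = −∫ p div u = 0` (the boundary term `∫_{∂B_R} p u·n → 0` because `p(t)` has
polynomial growth, `hp`, and `u(t)` is Schwartz). The torus twin is
`Literature.Analysis.FunctionSpaces.Torus.IsClassicalNSSolutionOn.energy_balance`. [cite: DoeringFoias2002, (2.4] -/
def IsClassicalNSSolutionOn.hasDerivWithinAt_kineticEnergy : Prop :=
  ∀ (h : IsClassicalNSSolutionOn S ν f u p) (hS : Convex ℝ S) (hu : HasUniformRapidDecayOn S u) {t : ℝ} (ht : t ∈ S) (hp : ∃ (C : ℝ) (k : ℕ), ∀ x, |p t x| ≤ C * (1 + ‖x‖) ^ k) (hf : Integrable (fun x => ⟪f t x, u t x⟫) (volume : Measure E)),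
    HasDerivWithinAt (fun s => VectorCalculus.kineticEnergy (u s))
      (-ν * VectorCalculus.gradNormSq (u t) + ∫ x, ⟪f t x, u t x⟫) S t

end Classical

/-! ### Bridge to the flat torus (`Literature.Torus`, G03 `TorusFluidGlue`) -/

section Torus

variable {d : Type*} [Fintype d]
variable {F : Type*} [NormedAddCommGroup F] [NormedSpace ℝ F]

/-- Space–time smoothness of the periodic lift `t ↦ Torus.lift (u t)` on `ℝ^d` is the torus
notion `Torus.IsSmoothSpaceTimeOn S u` — definitionally, since
`uncurry (fun t ↦ Torus.lift (u t)) = Torus.stLift u` (Fefferman, (8), (10)–(11): periodic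
smooth solutions on `ℝⁿ` are smooth solutions on `𝕋ⁿ`). [folklore] -/
theorem isSmoothSpaceTimeOn_iff_torus {S : Set ℝ} {u : ℝ → UnitAddTorus d → F} :
    IsSmoothSpaceTimeOn S (fun t => FunctionSpaces.Torus.lift (u t)) ↔ FunctionSpaces.Torus.IsSmoothSpaceTimeOn S u :=
  Iff.rfl

omit [Fintype d] in
/-- The one-sided time derivative commutes with the periodic lift (definitionally; not a `simp`
lemma since both sides unfold by `timeDerivWithin_apply`/`Torus.lift_apply`). [folklore] -/
theorem timeDerivWithin_lift (S : Set ℝ) (u : ℝ → UnitAddTorus d → F) (t : ℝ)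
    (y : EuclideanSpace ℝ d) :
    timeDerivWithin S (fun s => FunctionSpaces.Torus.lift (u s)) t y = FunctionSpaces.Torus.timeDerivWithin S u t (FunctionSpaces.Torus.proj y) :=
  rfl

variable [DecidableEq d]

/-- **Torus-to-space bridge.** A classical solution on the flat torus `𝕋^d × S`
(`Literature.Analysis.FunctionSpaces.Torus.IsClassicalNSSolutionOn`, G03) lifts to a (`ℤ^d`-periodic) classical solution on
`ℝ^d × S` with data `Torus.lift ∘ f`, `Torus.lift ∘ u`, `Torus.lift ∘ p` (Fefferman, (8),
(10)–(11): problems (B), (D) are posed for periodic fields on `ℝⁿ`). Smoothness is `Iff.rfl`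
(`isSmoothSpaceTimeOn_iff_torus`); the operators agree by translation invariance of `fderiv`,
`gradient`, `Δ` (`Torus.fderiv_lift`) and `Torus.isDivFree_iff_trace_fderiv_lift`. Source: the periodic
Clay problem is posed for `ℤ³`-periodic smooth fields on `ℝ³ × [0, ∞)`, "the domain is assumed to be the
torus `ℝ³/ℤ³`, i.e., one deals with periodical functions" (Lemarié-Rieusset 2016, §1.3, eqs. (1.10)–(1.13),
problems (B), (D)). Proved: `IsClassicalNSSolutionOn.of_torus_holds` (`ClassicalSolutionTorusProofs`).
[cite: LemarieRieusset2016, §1.3 eqs. (1.10)–(1.13)] -/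
def IsClassicalNSSolutionOn.of_torus : Prop :=
  ∀ {S : Set ℝ} {ν : ℝ} {f u : ℝ → UnitAddTorus d → EuclideanSpace ℝ d} {p : ℝ → UnitAddTorus d → ℝ} (h : FunctionSpaces.Torus.IsClassicalNSSolutionOn S ν f u p),
    IsClassicalNSSolutionOn S ν (fun t => FunctionSpaces.Torus.lift (f t)) (fun t => FunctionSpaces.Torus.lift (u t))
      (fun t => FunctionSpaces.Torus.lift (p t))

/-- Converse bridge: a classical solution on `ℝ^d × S` all of whose data are periodic lifts
descends to a classical solution on the torus (same identities as `of_torus`, read backwards;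
Fefferman, (8), (10); Lemarié-Rieusset 2016, §1.3, eqs. (1.10)–(1.13), problems (B), (D)). Proved:
`IsClassicalNSSolutionOn.to_torus_holds` (`ClassicalSolutionTorusProofs`).
[cite: LemarieRieusset2016, §1.3 eqs. (1.10)–(1.13)] -/
def IsClassicalNSSolutionOn.to_torus : Prop :=
  ∀ {S : Set ℝ} {ν : ℝ} {f u : ℝ → UnitAddTorus d → EuclideanSpace ℝ d} {p : ℝ → UnitAddTorus d → ℝ} (h : IsClassicalNSSolutionOn S ν (fun t => FunctionSpaces.Torus.lift (f t)) (fun t => FunctionSpaces.Torus.lift (u t)) (fun t => FunctionSpaces.Torus.lift (p t))),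
    FunctionSpaces.Torus.IsClassicalNSSolutionOn S ν f u p

/-- The two notions of classical solution agree on periodic lifts (`of_torus`, `to_torus`). Discharged:
`isClassicalNSSolutionOn_lift_iff_holds` (`ClassicalSolutionTorusProofs`). [folklore] -/
def isClassicalNSSolutionOn_lift_iff : Prop :=
  ∀ {S : Set ℝ} {ν : ℝ} {f u : ℝ → UnitAddTorus d → EuclideanSpace ℝ d} {p : ℝ → UnitAddTorus d → ℝ},
    IsClassicalNSSolutionOn S ν (fun t => FunctionSpaces.Torus.lift (f t)) (fun t => FunctionSpaces.Torus.lift (u t))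
        (fun t => FunctionSpaces.Torus.lift (p t)) ↔
      FunctionSpaces.Torus.IsClassicalNSSolutionOn S ν f u p

/- interim proof relied on results that are now named facts (D-0014); demoted to a fact by the M5 import, proof preserved:
:=
  ⟨IsClassicalNSSolutionOn.to_torus, IsClassicalNSSolutionOn.of_torus⟩
-/

end Torus

end Literature.Analysis.FluidPDE
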